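import Summits.AnomalousDissipation.AnomalousDissipation.Theorems.SolenoidalFractalHomogenisationLagrangianStepCellLawVOddGainDefectStrict
import HarnessLib

/-!
# The STRICT reversed-Minkowski inequality — §4: slot-dependent windows; the window clause discharged for symmetric blocks (K1L_D helper)

Fourth file of the split landing of planner ad-ideate-p5 g8's `Cruxes/LagrangianRenormalisationStep/OddGainDefect.lean` (FINAL = crux write 646be4e56a48,
786 l.; §0–§3 landed as `…CellLawVOddGainDefect{Gram,Cubature,Strict}` p649800/p650454/p650822, bodies byte-identical); content = §4 of that file:
`oddSectorial_excQS_strict_of_slotWindows` (slot-dependent transverse windows inside one box `[y, c·y]`), `dotProduct_self_eq_sum_sq`,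
`qsResp_window_symm` / `qsResp_window_symm_projPerp` (the extra window clause of the strict twin DISCHARGED for symmetric blocks:
`lo|x|² ≤ xᵀBx ≤ hi|x|²`, `B = Bᵀ`, `T ≥ 0` ⇒ `f_T(hi)|P_s x|² ≤ (P_s x)ᵀ f_T(B) (P_s x) ≤ f_T(lo)|P_s x|²`).
No named facts, no sorry. Lander: prover ad-k3l-bookkeeping-p1 g4 (tenure D24-10 fallback).
-/

set_option linter.dupNamespace false
set_option linter.style.longLine false

noncomputable section

namespace Summit.AnomalousDissipation.AnomalousDissipation.Theorems.SolenoidalFractalHomogenisation.LagrangianStep.OddGain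

open Matrix Finset
open Literature.Analysis.FluidPDE.KY (real_dot_eq)

/-! ## §4 Slot-dependent windows, and the window clause DISCHARGED for symmetric blocks (the `τ = 0` skeleton of O2⁺) -/

section Windows

open Literature.Analysis Literature.Analysis.FunctionSpaces Literature.Analysis.FluidPDE
open Literature.Analysis.FluidPDE.LatticeShear

/-- **Slot-dependent windows**: if slot `s` has its own transverse window `[ylo s, yhi s]·|P_s x|²` and ONE box `[y, c·y]` contains them all
(`y ≤ ylo s`, `yhi s ≤ c·y`), the strict contraction `oddSectorial_excQS_strict` applies with that box. [folklore] -/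
theorem oddSectorial_excQS_strict_of_slotWindows (Mlag : ℝ) (S : Torus.Visc4 (Fin 3)) {y c τ : ℝ} (hy : 0 ≤ y) (hc : 0 ≤ c) (hτ : 0 ≤ τ)
    (ylo yhi : Fin 26 → ℝ) (hlo : ∀ s, y ≤ ylo s) (hhi : ∀ s, yhi s ≤ c * y)
    (hsec : ∀ s, ∀ x z : Fin 3 → ℝ,
      (x ⬝ᵥ (slotQ cubatureWord Mlag S s) *ᵥ z - z ⬝ᵥ (slotQ cubatureWord Mlag S s) *ᵥ x) ^ 2 ≤
        τ ^ 2 * ((x ⬝ᵥ (slotQ cubatureWord Mlag S s) *ᵥ x) * (z ⬝ᵥ (slotQ cubatureWord Mlag S s) *ᵥ z)))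
    (hwin : ∀ s x, ylo s * perpSq (slotN s) x ≤ x ⬝ᵥ (slotQ cubatureWord Mlag S s) *ᵥ x ∧
      x ⬝ᵥ (slotQ cubatureWord Mlag S s) *ᵥ x ≤ yhi s * perpSq (slotN s) x) :
    OddSectorial (excQS cubatureWord Mlag S) (c * Real.sqrt 5 / 3 * τ) := by
  refine oddSectorial_excQS_strict Mlag S hy hc hτ hsec fun s x => ?_
  have hP := perpSq_nonneg (slotN s) x (slotN_unit s)
  exact ⟨(mul_le_mul_of_nonneg_right (hlo s) hP).trans (hwin s x).1, (hwin s x).2.trans (mul_le_mul_of_nonneg_right (hhi s) hP)⟩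

/-- `x·x = Σ xᵢ²`. -/
theorem dotProduct_self_eq_sum_sq (x : Fin 3 → ℝ) : x ⬝ᵥ x = ∑ i, x i ^ 2 := by
  simp [dotProduct, sq]

/-- **THE WINDOW CLAUSE FOR SYMMETRIC BLOCKS** (the `τ = 0` skeleton of the remaining per-slot obligation O2⁺): for a SYMMETRIC block `B`
with `lo|x|² ≤ xᵀBx ≤ hi|x|²` the quasi-static response is pinched `f_T(hi)|v|² ≤ vᵀ f_T(B) v ≤ f_T(lo)|v|²` on EVERY vector
(`f_T = qsRespScalar ρ T`, `T ≥ 0`) — the worker's Loewner pinch (p642614, invariant hyperplane `u = 0`) fed into the quasi-static pinch (p643071).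
For sectorial (non-symmetric) blocks the same window is expected up to `(1 + O(τ))` — NOT proved here. [folklore] -/
theorem qsResp_window_symm {ρ T lo hi : ℝ} (hT : 0 ≤ T) {B : Matrix (Fin 3) (Fin 3) ℝ} (hB : B.IsSymm)
    (hwin : ∀ x : Fin 3 → ℝ, lo * (x ⬝ᵥ x) ≤ x ⬝ᵥ B *ᵥ x ∧ x ⬝ᵥ B *ᵥ x ≤ hi * (x ⬝ᵥ x)) (v : Fin 3 → ℝ) :
    qsRespScalar ρ T hi * (v ⬝ᵥ v) ≤ v ⬝ᵥ (qsResp ρ T B) *ᵥ v ∧ v ⬝ᵥ (qsResp ρ T B) *ᵥ v ≤ qsRespScalar ρ T lo * (v ⬝ᵥ v) := by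
  have hu : ∀ j, ∑ i, (0 : Fin 3 → ℝ) i * B i j = 0 * (0 : Fin 3 → ℝ) j := by intro j; simp
  have hlo : ∀ w : Fin 3 → ℝ, ∑ i, (0 : Fin 3 → ℝ) i * w i = 0 → lo * ∑ i, w i ^ 2 ≤ ∑ i, ∑ j, w i * B i j * w j := by
    intro w _; rw [sum_sum_eq_form, ← dotProduct_self_eq_sum_sq]; exact (hwin w).1
  have hhi : ∀ w : Fin 3 → ℝ, ∑ i, (0 : Fin 3 → ℝ) i * w i = 0 → ∑ i, ∑ j, w i * B i j * w j ≤ hi * ∑ i, w i ^ 2 := by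
    intro w _; rw [sum_sum_eq_form, ← dotProduct_self_eq_sum_sq]; exact (hwin w).2
  have hv : ∑ i, (0 : Fin 3 → ℝ) i * v i = 0 := by simp
  have low := le_sum_sum_mul_qsResp_mul (ρ := ρ) hT (fun τ hτ => le_sum_mul_exp_neg_smul_mulVec_of_perp hB hu hhi hv hτ)
  have upp := sum_sum_mul_qsResp_mul_le (ρ := ρ) hT (fun τ hτ => sum_mul_exp_neg_smul_mulVec_le_of_perp hB hu hlo hv hτ)
  rw [sum_sum_eq_form, ← dotProduct_self_eq_sum_sq] at low upp
  exact ⟨low, upp⟩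

/-- … on the `P_s`-projected vectors, in the `perpSq` currency of this file: the extra clause of `oddSectorial_excQS_strict_of_slot` for a
symmetric block, with the slot window `[f_{T_s}(hi), f_{T_s}(lo)]`. [folklore] -/
theorem qsResp_window_symm_projPerp {ρ T lo hi : ℝ} (hT : 0 ≤ T) {B : Matrix (Fin 3) (Fin 3) ℝ} (hB : B.IsSymm)
    (hwin : ∀ x : Fin 3 → ℝ, lo * (x ⬝ᵥ x) ≤ x ⬝ᵥ B *ᵥ x ∧ x ⬝ᵥ B *ᵥ x ≤ hi * (x ⬝ᵥ x)) (s : Fin 26) (x : Fin 3 → ℝ) :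
    qsRespScalar ρ T hi * perpSq (slotN s) x ≤ ((projPerp (slotN s)) *ᵥ x) ⬝ᵥ (qsResp ρ T B) *ᵥ ((projPerp (slotN s)) *ᵥ x) ∧
    ((projPerp (slotN s)) *ᵥ x) ⬝ᵥ (qsResp ρ T B) *ᵥ ((projPerp (slotN s)) *ᵥ x) ≤ qsRespScalar ρ T lo * perpSq (slotN s) x := by
  have hn : ∑ a, slotN s a ^ 2 = 1 := by rw [← dotProduct_self_eq_sum_sq]; exact slotN_unit s
  rw [← perpSq_eq_projPerp (slotN s) x hn]
  exact qsResp_window_symm hT hB hwin _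

end Windows

end Summit.AnomalousDissipation.AnomalousDissipation.Theorems.SolenoidalFractalHomogenisation.LagrangianStep.OddGain

end
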